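import Literature.AnabelianGeometry.SemiGraphs.TemperedHostEdgeEndsOfTopCyclic
import Literature.AnabelianGeometry.SemiGraphs.TemperedEdgeLikeCentralizerTopCyclicTree
import Literature.AnabelianGeometry.SemiGraphs.TemperedPiVerticialLevelData
import Literature.AnabelianGeometry.SemiGraphs.TemperedEdgeLikeProofs
import HarnessLib

/-!
# [SemiAnbd] Cor 3.9 (R3c) `EdgeLikeCentralizerAt` at EVERY chart of EVERY graph of anabelioids with
# TOPOLOGICALLY CYCLIC edge groups — any underlying graph (proof-only)

Mochizuki, *Semi-graphs of anabelioids*, Publ. RIMS **42** (2006), §3, Corollary 3.9, proof p. 43 l. 13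
("[again by Theorem 3.7, (iii), (iv)]" — the cell's step (R3c), FACT-LIST rows F-2772
`EdgeLikeCentralizerAt` / F-2773 `EdgeLikeCentralizer`) [cite: MochizukiSemiAnbd2006, Cor 3.9 p.43].

PROOF-ONLY (cell abc-iut, block F, seat abc-iut-f-172 gen 7; file 5/5, the assembly of
«(R3c)@TOP-CYCLIC-CORE»; no definition, no named fact).
* `centralizer_le_verticial_of_topCyclic` — canonical chart, ALL edge groups topologically cyclic, NO
  hypothesis on the underlying semi-graph: for a compact `C ≠ 1` fixing the tree edges of an edge-point
  sequence `Q` over a base edge with two abutting branches, the centraliser of `C` lies in EVERY verticial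
  subgroup containing `C` (the prequel's two-point fixed locus `dist_le_four_of_fixed_pair` for the pair
  `(y, g·y)`, then abc-iut-f-172 gen 4's `mem_verticial_of_centralizer_of_bounded_displacement`).
* `exists_edgeSeq_fixing_of_le_of_mem_edgeLikeSubgroups` — canonical chart: a subgroup of an edge-like
  subgroup of `e` fixes the tree edges of some edge-point sequence over `e` (every edge-like subgroup is
  `ψ(Π_b)` for a verticial `ψ` = the decomposition homomorphism of a point sequence, un-glued along `b`).
* `edgeLikeCentralizerAt_of_topCyclic` — **F-2772 `EdgeLikeCentralizerAt ℋ c` at EVERY chart of every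
  graph of anabelioids `ℋ` satisfying the hypotheses of Cor. 3.9 ALL of whose edge groups are topologically
  cyclic (`ℤ_p`, `Ẑ`, …) — ANY underlying graph: cycles, loops, vertices of infinite valence,
  infinitely-branching cores (the ℵ₀-regular tree, the infinite bouquet `B_∞`, …)**; strictly beyond
  abc-iut-f-175 gen 3's tree class `edgeLikeCentralizerAt_of_topCyclic_of_isAcyclic` and abc-iut-f-176 gen
  4's `…_of_noHostableCore`; `edgeLikeCentralizer_of_topCyclic` — F-2773 RESTRICTED to that class,
  hypothesis-free.

Honest framing: statements about OUR typed tempered fundamental groups; the bare ∀-closure F-2773 (graphs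
carrying an edge group that is NOT topologically cyclic together with a core of hostable edges) is NOT
claimed; cone-irrelevant beyond finite dual graphs; no side taken on [IUTchIII] Cor. 3.12; typed ≠ proved
elsewhere.
-/

namespace Literature.AnabelianGeometry.SemiGraphs

namespace ProfiniteSemiGraph

open CategoryTheory Topology

universe u

variable (𝒢 : ProfiniteSemiGraph.{u}) (h37 : 𝒢.Thm37Hypotheses)

/-- **The centraliser lies in every verticial host — topologically cyclic edge groups, ANY underlying
graph** (canonical chart).  For `𝒢` satisfying the hypotheses of Thm. 3.7 with all edge groups topologically
cyclic, a compact `C ≠ 1` fixing the tree edges `Q.edge n` of an edge-point sequence `Q` over a base edge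
`e₀` with branches `b₁ ≠ b₂` at `v₁`, `v₂`, and ANY verticial `H ⊇ C`: `centralizer C ≤ H` — the pair
`(y, g·y)` stays at distance `≤ 4` (`dist_le_four_of_fixed_pair`), then abc-iut-f-172 gen 4's
`mem_verticial_of_centralizer_of_bounded_displacement`. [cite: MochizukiSemiAnbd2006, Cor 3.9 p.43] -/
theorem centralizer_le_verticial_of_topCyclic
    (hcyc : ∀ e : 𝒢.graph.Edge, ∃ t₀ : 𝒢.Ge e, (Subgroup.zpowers t₀).topologicalClosure = ⊤)
    (C : Subgroup (𝒢.temperedPiChart h37.toProp36Hypotheses).G)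
    (hCc : IsCompact (C : Set (𝒢.temperedPiChart h37.toProp36Hypotheses).G)) (hC : C ≠ ⊥)
    {e₀ : 𝒢.graph.Edge}
    (Q : (𝒢.galoisLevelData h37.toProp36Hypotheses).EdgeSeq h37.toProp36Hypotheses.isCountable e₀)
    (hQ : ∀ g ∈ C, ∀ n, ((𝒢.galoisLevelData h37.toProp36Hypotheses).treeAct
      h37.toProp36Hypotheses.isCountable n g).hom.edgeMap (Q.edge n) = Q.edge n)
    {b₁ b₂ : 𝒢.graph.Branch} (hb12 : b₁ ≠ b₂) (hb₁e : 𝒢.graph.edgeOf b₁ = e₀)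
    (hb₂e : 𝒢.graph.edgeOf b₂ = e₀) {v₁ v₂ : 𝒢.graph.Vertex} (hb₁ : 𝒢.graph.abuts b₁ = some v₁)
    (hb₂ : 𝒢.graph.abuts b₂ = some v₂)
    {v : 𝒢.graph.Vertex} {H : Subgroup (𝒢.temperedPiChart h37.toProp36Hypotheses).G}
    (hH : H ∈ verticialSubgroups (𝒢.temperedPiChart h37.toProp36Hypotheses) v) (hCH : C ≤ H) :
    Subgroup.centralizer (C : Set (𝒢.temperedPiChart h37.toProp36Hypotheses).G) ≤ H := by
  intro g hg
  obtain ⟨y, hyc, hyH⟩ := 𝒢.exists_fixed_system_of_mem_verticialSubgroups h37 hH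
  have hcomm : ∀ k ∈ C, k * g = g * k := fun k hk => Subgroup.mem_centralizer_iff.mp hg k hk
  have hyC : ∀ k ∈ C, ∀ j,
      ((verticialLevelData_temperedPiChart (h36 := h37.toProp36Hypotheses)).act j k).hom.vertexMap (y j) =
        y j := fun k hk j => hyH k (hCH hk) j
  have hy₁c := (verticialLevelData_temperedPiChart (h36 := h37.toProp36Hypotheses)).translate_compat' g hyc
  have hy₁C := (verticialLevelData_temperedPiChart (h36 := h37.toProp36Hypotheses)).translate_fixed' hcomm hyC
  exact 𝒢.mem_verticial_of_centralizer_of_bounded_displacement h37 C hCc hC hH hCH y hyc hyH g hg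
    ⟨4, fun j => 𝒢.dist_le_four_of_fixed_pair h37 hcyc C hC Q hQ hb12 hb₁e hb₂e hb₁ hb₂ y
      (fun j => ((verticialLevelData_temperedPiChart (h36 := h37.toProp36Hypotheses)).act j g).hom.vertexMap
        (y j)) hyc hy₁c hyC hy₁C j⟩

/-- **A subgroup of an edge-like subgroup fixes the tree edges of an edge-point sequence** (canonical
chart): if `C ≤ L` with `L` edge-like at the edge of a branch `b` abutting to `w`, then `C` fixes the edges
`Q.edge n` of some compatible edge-point sequence `Q` over that edge — `L = ψ(Π_b)` for a verticial `ψ` at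
`w` (`exists_eq_map_branchSubgroup_of_mem_edgeLikeSubgroups`), `ψ` is the decomposition homomorphism of a
point sequence `P` (`exists_pointSeq_of_isVerticialHom`), and `Q := P` un-glued along `b` has edge
decomposition homomorphism `ψ ∘ b_*` (`decompHomE_toEdgeSeq`), whose image fixes `Q.edge n`.
[cite: MochizukiSemiAnbd2006, Thm 3.7(iii) p.41] -/
theorem exists_edgeSeq_fixing_of_le_of_mem_edgeLikeSubgroups
    (C L : Subgroup (𝒢.temperedPiChart h37.toProp36Hypotheses).G) {b : 𝒢.graph.Branch}
    {w : 𝒢.graph.Vertex} (hb : 𝒢.graph.abuts b = some w)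
    (hL : L ∈ edgeLikeSubgroups (𝒢.temperedPiChart h37.toProp36Hypotheses) (𝒢.graph.edgeOf b))
    (hCL : C ≤ L) :
    ∃ Q : (𝒢.galoisLevelData h37.toProp36Hypotheses).EdgeSeq h37.toProp36Hypotheses.isCountable
        (𝒢.graph.edgeOf b),
      ∀ g ∈ C, ∀ n, ((𝒢.galoisLevelData h37.toProp36Hypotheses).treeAct
        h37.toProp36Hypotheses.isCountable n g).hom.edgeMap (Q.edge n) = Q.edge n := by
  obtain ⟨P₀⟩ := GaloisLevelData.nonempty_pointSeq h37.toProp36Hypotheses w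
  obtain ⟨ψ, hψ, hLψ⟩ := exists_eq_map_branchSubgroup_of_mem_edgeLikeSubgroups
    (𝒢.temperedPiChart h37.toProp36Hypotheses) b w hb ⟨P₀.decompHomCont, P₀.isVerticialHom_decompHomCont⟩ hL
  obtain ⟨P, hP⟩ := exists_pointSeq_of_isVerticialHom (h36 := h37.toProp36Hypotheses) hψ
  refine ⟨P.toEdgeSeq b hb, fun g hg n => ?_⟩
  have hgL : g ∈ (𝒢.branchSubgroup b w hb).map ψ.toMonoidHom := hLψ ▸ hCL hg
  obtain ⟨k', ⟨k, rfl⟩, rfl⟩ := hgL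
  have hk : ψ.toMonoidHom ((𝒢.brHom b w hb).toMonoidHom k) =
      (P.toEdgeSeq b hb).decompHomE h37.isConnected k := by
    rw [P.decompHomE_toEdgeSeq b hb h37.isConnected, MonoidHom.comp_apply, hP]
    rfl
  rw [hk]
  exact (P.toEdgeSeq b hb).treeAct_decompHomE_edgeMap h37.isConnected n k

variable {𝒢} {ℋ : ProfiniteSemiGraph.{u}}

/-- **(R3c) F-2772 `EdgeLikeCentralizerAt ℋ c` at EVERY chart of every graph of anabelioids with
TOPOLOGICALLY CYCLIC edge groups** satisfying the hypotheses of [SemiAnbd] Cor. 3.9 — ANY underlying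
graph: cycles, loops, vertices of infinite valence, infinitely-branching cores.  The open piece `ψ(U)` is
compact and nontrivial (`isCompact_map_and_ne_bot_of_isEdgeHom`); transported to the canonical chart
(`TemperedPiChart.exists_compatIso`) it lies in an edge-like subgroup, hence fixes the tree edges of an
edge-point sequence (`exists_edgeSeq_fixing_of_le_of_mem_edgeLikeSubgroups`), and
`centralizer_le_verticial_of_topCyclic` applies. [cite: MochizukiSemiAnbd2006, Cor 3.9 p.43] -/
theorem edgeLikeCentralizerAt_of_topCyclic (hℋ : Cor39Hypotheses ℋ)
    (hcyc : ∀ e : ℋ.graph.Edge, ∃ t₀ : ℋ.Ge e, (Subgroup.zpowers t₀).topologicalClosure = ⊤)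
    (c : TemperedPiChart ℋ) : EdgeLikeCentralizerAt ℋ c := by
  intro e ψ hψ U hU v H hH hUH
  have h37 : ℋ.Thm37Hypotheses := hℋ.thm37Hypotheses
  obtain ⟨hCc, hC⟩ := isCompact_map_and_ne_bot_of_isEdgeHom hℋ c e ψ hψ U hU
  -- the two branches of `e` and their vertices
  obtain ⟨b₁, b₂, hb12, hb₁e, hb₂e, -⟩ := ℋ.graph.two_branches e
  obtain ⟨w₁, hw₁⟩ := Option.isSome_iff_exists.mp (hℋ.isGraph.abuts_isSome b₁)
  obtain ⟨w₂, hw₂⟩ := Option.isSome_iff_exists.mp (hℋ.isGraph.abuts_isSome b₂)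
  -- transport to the canonical chart `c₀`
  obtain ⟨φ, ψ', hψφ, hφψ, hφ, hψ'⟩ :=
    TemperedPiChart.exists_compatIso (ℋ.temperedPiChart h37.toProp36Hypotheses) c
  have hinj : Function.Injective ψ' := fun y₁ y₂ h => by rw [← hφψ y₁, ← hφψ y₂, h]
  have hmapV : ∀ {w : ℋ.graph.Vertex} {K : Subgroup c.G}, K ∈ verticialSubgroups c w →
      K.map ψ'.toMonoidHom ∈ verticialSubgroups (ℋ.temperedPiChart h37.toProp36Hypotheses) w :=
    fun hK => (mem_verticialSubgroups_iff_map φ hφ ψ' hφψ hψ' _).mp hK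
  have hL : ψ.range.map ψ'.toMonoidHom ∈
      edgeLikeSubgroups (ℋ.temperedPiChart h37.toProp36Hypotheses) (ℋ.graph.edgeOf b₁) := by
    rw [hb₁e]
    exact (mem_edgeLikeSubgroups_iff_map φ hφ ψ' hφψ hψ' _).mp ⟨ψ, hψ, rfl⟩
  have hC₀c : IsCompact (((U.map ψ.toMonoidHom).map ψ'.toMonoidHom :
      Subgroup (ℋ.temperedPiChart h37.toProp36Hypotheses).G) :
        Set (ℋ.temperedPiChart h37.toProp36Hypotheses).G) := by
    rw [Subgroup.coe_map]
    exact hCc.image ψ'.continuous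
  have hC₀ : (U.map ψ.toMonoidHom).map ψ'.toMonoidHom ≠ ⊥ := fun h0 =>
    hC ((Subgroup.map_eq_bot_iff_of_injective (U.map ψ.toMonoidHom) hinj).mp h0)
  have hC₀L : (U.map ψ.toMonoidHom).map ψ'.toMonoidHom ≤ ψ.range.map ψ'.toMonoidHom :=
    Subgroup.map_mono (Subgroup.map_le_range _ _)
  -- the host edge-point sequence over `e = edgeOf b₁`
  obtain ⟨Q, hQ⟩ := ℋ.exists_edgeSeq_fixing_of_le_of_mem_edgeLikeSubgroups h37 _ _ hw₁ hL hC₀L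
  intro g hg
  have hg₀ : ψ' g ∈ Subgroup.centralizer ((((U.map ψ.toMonoidHom).map ψ'.toMonoidHom :
      Subgroup (ℋ.temperedPiChart h37.toProp36Hypotheses).G)) :
        Set (ℋ.temperedPiChart h37.toProp36Hypotheses).G) := by
    refine Subgroup.mem_centralizer_iff.mpr ?_
    rintro _ ⟨k, hk, rfl⟩
    have hkg : k * g = g * k := Subgroup.mem_centralizer_iff.mp hg k hk
    change ψ' k * ψ' g = ψ' g * ψ' k
    rw [← map_mul, ← map_mul, hkg]
  have hmem : ψ' g ∈ H.map ψ'.toMonoidHom :=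
    ℋ.centralizer_le_verticial_of_topCyclic h37 hcyc _ hC₀c hC₀ Q hQ hb12 rfl (hb₂e.trans hb₁e.symm) hw₁ hw₂
      (hmapV hH) (Subgroup.map_mono hUH) hg₀
  obtain ⟨h, hh, hhg⟩ := hmem
  have hhg' : h = g := hinj hhg
  exact hhg' ▸ hh

/-- **F-2773 `EdgeLikeCentralizer` RESTRICTED to graphs of anabelioids with topologically cyclic edge
groups, hypothesis-free** — any underlying graph.  (The bare ∀-countable fact additionally ranges over
graphs carrying a NON-topologically-cyclic edge group — not claimed.) [cite: MochizukiSemiAnbd2006, Cor 3.9 p.43] -/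
theorem edgeLikeCentralizer_of_topCyclic :
    ∀ (ℋ : ProfiniteSemiGraph.{u}), Cor39Hypotheses ℋ →
      (∀ e : ℋ.graph.Edge, ∃ t₀ : ℋ.Ge e, (Subgroup.zpowers t₀).topologicalClosure = ⊤) →
      ∀ (c : TemperedPiChart ℋ), EdgeLikeCentralizerAt ℋ c :=
  fun _ hℋ hcyc c => edgeLikeCentralizerAt_of_topCyclic hℋ hcyc c

end ProfiniteSemiGraph

end Literature.AnabelianGeometry.SemiGraphs
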